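import Summits.RiemannHypothesis.RiemannHypothesis.Theorems.PfPersistenceRatioShortWindowForm
import Summits.RiemannHypothesis.RiemannHypothesis.Theorems.PfPersistenceEdgeLawCutBound
import HarnessLib

/-!
# PF persistence — leaf G1.21b `(Z)`-cell: THE GUARDED RATIO CLASSES ARE SETTLED AT SHORT WINDOWS (RH-free)

Helper file (`--supports stmt-RiemannHypothesis-19953`); mechanism/rigidity campaign; no RH claims.

`PfPersistenceRatioUnguardedSettled` closed the UNGUARDED ∀-window ratio classes at the degenerate windows
`N = 0`.  The GUARDED classes of `PfPersistenceRatioDegenerateWindow` (`GaugeRatioClassPos τ`: `|ε₁| ≤ τ(ε₂ − ε₁)`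
at every window with `0 < N`; `ModulusRatioClassPos κ`: `|ε₁| ≤ κ|ε₂|` there) were the standing objects of the
cell's CONDITIONAL words, with the premise `ζ ∈ GaugeRatioClassPos τ` recorded OPEN / DATA-supported.  This file
REFUTES that premise and settles the guarded rows, RH-free, by the SHORT-WINDOW SANDWICH of
`PfPersistenceRatioShortWindowForm` (`exists_shortWindow_sandwich`: at the window `(a, 1)`, `a ≤ a₀`,
`log(1/a) − c ≤ ε₁(ζ) ≤ ε₂(ζ) ≤ log(1/a) + 55`): the ratio conjuncts are scale-free, the gap `ε₂ − ε₁` of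
`ζ`'s two-dimensional block is bounded, and its bottom `ε₁ ~ log(1/a) → +∞`; so for EVERY `τ : ℝ`
(resp. every `κ < 1`) there is a depth `a₁(τ) > 0` below which the gauge (resp. modulus) conjunct at `(a, 1)`
REJECTS every datum that agrees with `ζ` at that window (`exists_shortWindow_not_mem_gaugeRatioAt`,
`exists_shortWindow_not_mem_modulusRatioAt`).  Consequences (all PROVED, RH-free, no DATA):

* `zeta_not_mem_gaugeRatioClassPos` (every `τ`), `zeta_not_mem_modulusRatioClassPos` (`κ < 1`);
* `not_separates_of_subset_gaugeRatioClassPos`, `…modulus…` — no sub-class of a guarded ratio class separates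
  `ζ` from anything over any domain (W0: `ζ ∉ S`); single-window versions at `(a, 1)`, `a ≤ a₁(τ)`;
* `datumOf_not_mem_gaugeRatioClassPos_of_originFree`, `disjoint_gaugeRatioClassPos_originFreeDialSpace`,
  `…arithDialSpace`, `dial_not_mem_gaugeRatioClassPos` (+ modulus twins) — the guarded classes miss the whole
  origin-free dial space (every origin-free datum coincides with `ζ` at windows with `e^{2a} < 2`), in particular
  contain NO dial of `ζ`: the cluster-binder isolation packages (`ClusterReady`, `ClusterBinders`) are no longer
  load-bearing for the ∀-window classes;
* `guardedRatioClasses_settled` — ledger summary.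

Reading for the leaf: a sign-blind ratio class can only be a live object of words WITH A WINDOW FLOOR `a ≥ a_min`
(far windows, where the DATA and the dial-isolation packages live); every ∀-window version — guarded or not — is
closed W0 (`ζ`-free), RH-free.
-/

set_option linter.dupNamespace false

noncomputable section

open Real Set Matrix

namespace Summit.RiemannHypothesis.RiemannHypothesis.Theorems.PfPersistence

open Literature.NumberTheory.LFunctions

/-! ## §1 Level arithmetic: a bounded gap over a high bottom violates both ratio conjuncts -/

/-- PROVED: if at a window `ℓ − c ≤ ε₁ ≤ ε₂ ≤ ℓ + 55` and `max(τ,0)·(55 + c) < ℓ − c`, the gauge conjunct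
`|ε₁| ≤ τ(ε₂ − ε₁)` fails there. [folklore] -/
theorem not_mem_gaugeRatioAt_of_levels {d : Datum} {win : Window} {τ ℓ c : ℝ}
    (hK : max τ 0 * (55 + c) < ℓ - c) (h1 : ℓ - c ≤ bottomRayleigh (d win))
    (h12 : bottomRayleigh (d win) ≤ secondRayleigh (d win)) (h2 : secondRayleigh (d win) ≤ ℓ + 55) :
    d ∉ gaugeRatioAt τ win := by
  intro h
  simp only [gaugeRatioAt, Set.mem_setOf_eq] at h
  have hG : bottomGapGauge d win = secondRayleigh (d win) - bottomRayleigh (d win) := rfl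
  rw [hG] at h
  have hG0 : 0 ≤ secondRayleigh (d win) - bottomRayleigh (d win) := by linarith
  have hGle : secondRayleigh (d win) - bottomRayleigh (d win) ≤ 55 + c := by linarith
  have hm1 : τ * (secondRayleigh (d win) - bottomRayleigh (d win)) ≤
      max τ 0 * (secondRayleigh (d win) - bottomRayleigh (d win)) :=
    mul_le_mul_of_nonneg_right (le_max_left τ 0) hG0
  have hm2 : max τ 0 * (secondRayleigh (d win) - bottomRayleigh (d win)) ≤ max τ 0 * (55 + c) :=
    mul_le_mul_of_nonneg_left hGle (le_max_right τ 0)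
  have habs := le_abs_self (bottomRayleigh (d win))
  linarith

/-- PROVED: if at a window `0 ≤ ℓ − c ≤ ε₁ ≤ ε₂ ≤ ℓ + 55` and `max(κ,0)·(ℓ + 55) < ℓ − c`, the modulus conjunct
`|ε₁| ≤ κ|ε₂|` fails there. [folklore] -/
theorem not_mem_modulusRatioAt_of_levels {d : Datum} {win : Window} {κ ℓ c : ℝ} (h0 : 0 ≤ ℓ - c)
    (hK : max κ 0 * (ℓ + 55) < ℓ - c) (h1 : ℓ - c ≤ bottomRayleigh (d win))
    (h12 : bottomRayleigh (d win) ≤ secondRayleigh (d win)) (h2 : secondRayleigh (d win) ≤ ℓ + 55) :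
    d ∉ modulusRatioAt κ win := by
  intro h
  simp only [modulusRatioAt, Set.mem_setOf_eq] at h
  have hε2 : 0 ≤ secondRayleigh (d win) := by linarith
  rw [abs_of_nonneg hε2] at h
  have hm1 : κ * secondRayleigh (d win) ≤ max κ 0 * secondRayleigh (d win) :=
    mul_le_mul_of_nonneg_right (le_max_left κ 0) hε2
  have hm2 : max κ 0 * secondRayleigh (d win) ≤ max κ 0 * (ℓ + 55) :=
    mul_le_mul_of_nonneg_left h2 (le_max_right κ 0)
  have habs := le_abs_self (bottomRayleigh (d win))
  linarith

/-! ## §2 Below a depth `a₁(τ)` the conjunct at `(a, 1)` rejects everything that agrees with `ζ` there -/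

/-- **PROVED (RH-free): THE GAUGE CONJUNCT REJECTS `ζ` AT DEEP SHORT WINDOWS, FOR EVERY `τ`.**  For every
`τ : ℝ` there is `a₁ ∈ (0, 1/5]` such that for all `0 < a ≤ a₁`, every datum `d` with `d(a,1) = ζ(a,1)` violates
`|ε₁| ≤ τ(ε₂ − ε₁)` at the window `(a, 1)`. [folklore] -/
theorem exists_shortWindow_not_mem_gaugeRatioAt (τ : ℝ) :
    ∃ a₁ : ℝ, 0 < a₁ ∧ a₁ ≤ 1 / 5 ∧ ∀ (a : ℝ) (ha : 0 < a), a ≤ a₁ →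
      ∀ d : Datum, d ⟨a, 1, ha⟩ = zetaDatum ⟨a, 1, ha⟩ → d ∉ gaugeRatioAt τ ⟨a, 1, ha⟩ := by
  obtain ⟨c, a₀, ha₀, ha₅, H⟩ := exists_shortWindow_sandwich
  set K : ℝ := |c| + max τ 0 * (55 + c) + 1 with hK
  refine ⟨min a₀ (Real.exp (-K)), lt_min ha₀ (Real.exp_pos _), (min_le_left _ _).trans ha₅,
    fun a ha hale d hd => ?_⟩
  obtain ⟨h1, h12, h2⟩ := H a ha (hale.trans (min_le_left _ _))
  have hℓ : K ≤ Real.log (1 / a) := le_log_one_div_of_le_exp_neg ha (hale.trans (min_le_right _ _))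
  have hc : c ≤ |c| := le_abs_self c
  refine not_mem_gaugeRatioAt_of_levels (ℓ := Real.log (1 / a)) (c := c) (by linarith) ?_ ?_ ?_
  · rw [hd]; exact h1
  · rw [hd]; exact h12
  · rw [hd]; exact h2

/-- **PROVED (RH-free): THE MODULUS CONJUNCT REJECTS `ζ` AT DEEP SHORT WINDOWS, FOR EVERY `κ < 1`.** [folklore] -/
theorem exists_shortWindow_not_mem_modulusRatioAt {κ : ℝ} (hκ : κ < 1) :
    ∃ a₁ : ℝ, 0 < a₁ ∧ a₁ ≤ 1 / 5 ∧ ∀ (a : ℝ) (ha : 0 < a), a ≤ a₁ →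
      ∀ d : Datum, d ⟨a, 1, ha⟩ = zetaDatum ⟨a, 1, ha⟩ → d ∉ modulusRatioAt κ ⟨a, 1, ha⟩ := by
  obtain ⟨c, a₀, ha₀, ha₅, H⟩ := exists_shortWindow_sandwich
  have hk0 : 0 ≤ max κ 0 := le_max_right _ _
  have hk1 : max κ 0 < 1 := max_lt hκ one_pos
  set K : ℝ := (|c| + 56) / (1 - max κ 0) with hK
  have hKmul : K * (1 - max κ 0) = |c| + 56 := by
    rw [hK]; exact div_mul_cancel₀ _ (by linarith)
  refine ⟨min a₀ (Real.exp (-K)), lt_min ha₀ (Real.exp_pos _), (min_le_left _ _).trans ha₅,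
    fun a ha hale d hd => ?_⟩
  obtain ⟨h1, h12, h2⟩ := H a ha (hale.trans (min_le_left _ _))
  have hℓ : K ≤ Real.log (1 / a) := le_log_one_div_of_le_exp_neg ha (hale.trans (min_le_right _ _))
  have hc : c ≤ |c| := le_abs_self c
  have hc' : -c ≤ |c| := neg_le_abs c
  have hprod : K * (1 - max κ 0) ≤ Real.log (1 / a) * (1 - max κ 0) :=
    mul_le_mul_of_nonneg_right hℓ (by linarith)
  have hKℓ : max κ 0 * (Real.log (1 / a) + 55) < Real.log (1 / a) - c := by nlinarith
  have h0 : 0 ≤ Real.log (1 / a) - c := by nlinarith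
  refine not_mem_modulusRatioAt_of_levels (ℓ := Real.log (1 / a)) (c := c) h0 hKℓ ?_ ?_ ?_
  · rw [hd]; exact h1
  · rw [hd]; exact h12
  · rw [hd]; exact h2

/-! ## §3 `ζ` lies in NO guarded ratio class; the guarded rows are settled W0 (RH-free) -/

/-- **PROVED (RH-free): `ζ ∉ GaugeRatioClassPos τ` for EVERY `τ : ℝ`** — the premise of the cell's CONDITIONAL
words on the guarded gauge class is REFUTED (not merely DATA-doubted). [folklore] -/
theorem zeta_not_mem_gaugeRatioClassPos (τ : ℝ) : zetaDatum ∉ GaugeRatioClassPos τ := by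
  obtain ⟨a₁, ha₁, -, H⟩ := exists_shortWindow_not_mem_gaugeRatioAt τ
  exact fun h => H a₁ ha₁ le_rfl zetaDatum rfl (h ⟨a₁, 1, ha₁⟩ Nat.one_pos)

/-- **PROVED (RH-free): `ζ ∉ ModulusRatioClassPos κ` for every `κ < 1`.** [folklore] -/
theorem zeta_not_mem_modulusRatioClassPos {κ : ℝ} (hκ : κ < 1) : zetaDatum ∉ ModulusRatioClassPos κ := by
  obtain ⟨a₁, ha₁, -, H⟩ := exists_shortWindow_not_mem_modulusRatioAt hκ
  exact fun h => H a₁ ha₁ le_rfl zetaDatum rfl (h ⟨a₁, 1, ha₁⟩ Nat.one_pos)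

/-- **PROVED (RH-free) — THE GUARDED GAUGE ROW IS SETTLED: no `S ⊆ GaugeRatioClassPos τ` separates `ζ` from
anything, over ANY domain, for ANY `τ`** (`ζ ∉ S`). [folklore] -/
theorem not_separates_of_subset_gaugeRatioClassPos {S : Set Datum} {τ : ℝ} (hS : S ⊆ GaugeRatioClassPos τ)
    (D : Set Datum) : ¬ Separates S D zetaDatum :=
  fun hsep => zeta_not_mem_gaugeRatioClassPos τ (hS hsep.1)

/-- **PROVED (RH-free) — THE GUARDED MODULUS ROW IS SETTLED for `κ < 1`.** [folklore] -/
theorem not_separates_of_subset_modulusRatioClassPos {S : Set Datum} {κ : ℝ} (hS : S ⊆ ModulusRatioClassPos κ)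
    (hκ : κ < 1) (D : Set Datum) : ¬ Separates S D zetaDatum :=
  fun hsep => zeta_not_mem_modulusRatioClassPos hκ (hS hsep.1)

/-- PROVED (RH-free): even ONE deep non-degenerate short-window gauge conjunct excludes `ζ` — for every `τ` there is
`a₁ > 0` such that no `S ⊆ gaugeRatioAt τ ⟨a, 1⟩`, `a ≤ a₁`, separates `ζ` from anything. [folklore] -/
theorem exists_shortWindow_not_separates_gauge (τ : ℝ) :
    ∃ a₁ : ℝ, 0 < a₁ ∧ ∀ (a : ℝ) (ha : 0 < a), a ≤ a₁ →
      ∀ S D : Set Datum, S ⊆ gaugeRatioAt τ ⟨a, 1, ha⟩ → ¬ Separates S D zetaDatum := by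
  obtain ⟨a₁, ha₁, -, H⟩ := exists_shortWindow_not_mem_gaugeRatioAt τ
  exact ⟨a₁, ha₁, fun a ha hale S D hS hsep => H a ha hale zetaDatum rfl (hS hsep.1)⟩

/-- PROVED (RH-free): the modulus twin, `κ < 1`. [folklore] -/
theorem exists_shortWindow_not_separates_modulus {κ : ℝ} (hκ : κ < 1) :
    ∃ a₁ : ℝ, 0 < a₁ ∧ ∀ (a : ℝ) (ha : 0 < a), a ≤ a₁ →
      ∀ S D : Set Datum, S ⊆ modulusRatioAt κ ⟨a, 1, ha⟩ → ¬ Separates S D zetaDatum := by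
  obtain ⟨a₁, ha₁, -, H⟩ := exists_shortWindow_not_mem_modulusRatioAt hκ
  exact ⟨a₁, ha₁, fun a ha hale S D hS hsep => H a ha hale zetaDatum rfl (hS hsep.1)⟩

/-! ## §4 The whole origin-free dial space is excluded from the guarded classes (RH-free) -/

/-- PROVED: an origin-free datum coincides with `ζ` at every window `(a, 1)` with `a ≤ 1/5` (no prime power has
`log n ≤ 2a`; `evenBlock_eq_of_originFree`). [folklore] -/
theorem datumOf_apply_eq_zeta_of_originFree {w : Weights} (hw : w ∈ originFreeWeights) {a : ℝ} (ha : 0 < a)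
    (h5 : a ≤ 1 / 5) : datumOf w ⟨a, 1, ha⟩ = zetaDatum ⟨a, 1, ha⟩ := by
  have h2 : Real.exp (2 * a) < 2 :=
    lt_of_le_of_lt (Real.exp_le_exp.2 (by linarith)) exp_two_mul_fifth_lt_two
  exact evenBlock_eq_of_originFree hw zetaWeights_mem_originFreeWeights (win := ⟨a, 1, ha⟩) h2

/-- **PROVED (RH-free): every origin-free datum lies outside `GaugeRatioClassPos τ`, for every `τ`.** [folklore] -/
theorem datumOf_not_mem_gaugeRatioClassPos_of_originFree {w : Weights} (hw : w ∈ originFreeWeights) (τ : ℝ) :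
    datumOf w ∉ GaugeRatioClassPos τ := by
  obtain ⟨a₁, ha₁, ha₅, H⟩ := exists_shortWindow_not_mem_gaugeRatioAt τ
  exact fun h => H a₁ ha₁ le_rfl (datumOf w) (datumOf_apply_eq_zeta_of_originFree hw ha₁ ha₅)
    (h ⟨a₁, 1, ha₁⟩ Nat.one_pos)

/-- PROVED (RH-free): every origin-free datum lies outside `ModulusRatioClassPos κ`, `κ < 1`. [folklore] -/
theorem datumOf_not_mem_modulusRatioClassPos_of_originFree {w : Weights} (hw : w ∈ originFreeWeights) {κ : ℝ}
    (hκ : κ < 1) : datumOf w ∉ ModulusRatioClassPos κ := by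
  obtain ⟨a₁, ha₁, ha₅, H⟩ := exists_shortWindow_not_mem_modulusRatioAt hκ
  exact fun h => H a₁ ha₁ le_rfl (datumOf w) (datumOf_apply_eq_zeta_of_originFree hw ha₁ ha₅)
    (h ⟨a₁, 1, ha₁⟩ Nat.one_pos)

/-- **PROVED (RH-free): `GaugeRatioClassPos τ` is DISJOINT from the origin-free dial space, every `τ`.** [folklore] -/
theorem disjoint_gaugeRatioClassPos_originFreeDialSpace (τ : ℝ) :
    Disjoint (GaugeRatioClassPos τ) originFreeDialSpace := by
  refine Set.disjoint_right.2 ?_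
  rintro _ ⟨w, hw, rfl⟩
  exact datumOf_not_mem_gaugeRatioClassPos_of_originFree hw τ

/-- PROVED (RH-free): `GaugeRatioClassPos τ` is disjoint from the arithmetic dial space, every `τ`. [folklore] -/
theorem disjoint_gaugeRatioClassPos_arithDialSpace (τ : ℝ) : Disjoint (GaugeRatioClassPos τ) arithDialSpace :=
  (disjoint_gaugeRatioClassPos_originFreeDialSpace τ).mono_right arithDialSpace_subset_originFreeDialSpace

/-- PROVED (RH-free): `ModulusRatioClassPos κ`, `κ < 1`, is disjoint from the origin-free dial space. [folklore] -/
theorem disjoint_modulusRatioClassPos_originFreeDialSpace {κ : ℝ} (hκ : κ < 1) :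
    Disjoint (ModulusRatioClassPos κ) originFreeDialSpace := by
  refine Set.disjoint_right.2 ?_
  rintro _ ⟨w, hw, rfl⟩
  exact datumOf_not_mem_modulusRatioClassPos_of_originFree hw hκ

/-- PROVED (RH-free): `ModulusRatioClassPos κ`, `κ < 1`, is disjoint from the arithmetic dial space. [folklore] -/
theorem disjoint_modulusRatioClassPos_arithDialSpace {κ : ℝ} (hκ : κ < 1) :
    Disjoint (ModulusRatioClassPos κ) arithDialSpace :=
  (disjoint_modulusRatioClassPos_originFreeDialSpace hκ).mono_right arithDialSpace_subset_originFreeDialSpace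

/-- **PROVED (RH-free): NO dial of `ζ` — any position `p`, any amplitude `K` — lies in `GaugeRatioClassPos τ`, for
any `τ`: BINDER-FREE** (supersedes, for the ∀-window class, the isolation theorems modulo `ClusterReady` /
`ClusterBinders` of `PfPersistenceRatioClusterReady` / `PfPersistenceRatioGuardedIsolation`). [folklore] -/
theorem dial_not_mem_gaugeRatioClassPos (p : ℕ) (K τ : ℝ) :
    datumOf (dial p K zetaWeights) ∉ GaugeRatioClassPos τ :=
  datumOf_not_mem_gaugeRatioClassPos_of_originFree
    (dial_mem_originFreeWeights p K zetaWeights_mem_originFreeWeights) τ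

/-- PROVED (RH-free): no dial of `ζ` lies in `ModulusRatioClassPos κ`, `κ < 1` (binder-free). [folklore] -/
theorem dial_not_mem_modulusRatioClassPos (p : ℕ) (K : ℝ) {κ : ℝ} (hκ : κ < 1) :
    datumOf (dial p K zetaWeights) ∉ ModulusRatioClassPos κ :=
  datumOf_not_mem_modulusRatioClassPos_of_originFree
    (dial_mem_originFreeWeights p K zetaWeights_mem_originFreeWeights) hκ

/-- **PROVED (RH-free) — SUMMARY for the ledger:** for every `τ : ℝ` and every `κ < 1`, (i) `ζ ∉ GaugeRatioClassPos τ`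
and `ζ ∉ ModulusRatioClassPos κ`; (ii) both guarded classes miss the whole origin-free dial space (hence contain no
dial of `ζ`); (iii) no sub-class of either separates `ζ` over any domain.  Together with
`unguardedRatioClasses_settled` every ∀-window sign-blind ratio class of the `(Z)`-cell is closed W0. [folklore] -/
theorem guardedRatioClasses_settled (τ : ℝ) {κ : ℝ} (hκ : κ < 1) :
    zetaDatum ∉ GaugeRatioClassPos τ ∧ zetaDatum ∉ ModulusRatioClassPos κ ∧
      Disjoint (GaugeRatioClassPos τ) originFreeDialSpace ∧
      Disjoint (ModulusRatioClassPos κ) originFreeDialSpace ∧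
      (∀ S D : Set Datum, S ⊆ GaugeRatioClassPos τ → ¬ Separates S D zetaDatum) ∧
      ∀ S D : Set Datum, S ⊆ ModulusRatioClassPos κ → ¬ Separates S D zetaDatum :=
  ⟨zeta_not_mem_gaugeRatioClassPos τ, zeta_not_mem_modulusRatioClassPos hκ,
    disjoint_gaugeRatioClassPos_originFreeDialSpace τ, disjoint_modulusRatioClassPos_originFreeDialSpace hκ,
    fun _ D hS => not_separates_of_subset_gaugeRatioClassPos hS D,
    fun _ D hS => not_separates_of_subset_modulusRatioClassPos hS hκ D⟩

end Summit.RiemannHypothesis.RiemannHypothesis.Theorems.PfPersistence
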